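import Summits.BirchSwinnertonDyer.BirchSwinnertonDyer.Theorems.Rank2ObservatoryRank2Census
import Summits.BirchSwinnertonDyer.BirchSwinnertonDyer.Theorems.Rank2ObservatoryKernelCertsE01
import HarnessLib

/-!
# BirchSwinnertonDyer — rank ≥ 2 observatory: kernel rank certificates, census index E61

HONEST FRAMING: per-curve certified theorems and census instruments; no claim on BSD in rank ≥ 2.

The 1 rank-2 census rows (`Rank2Row` literals = rows of `rank2_table.tsv`, sha256
`8b151c933b69ee8dae4834c21efd171353ae94c887716c05b7381d12d173f912`, labels `308490bx1` …
`308490bx1`, conductor `308490`–`308490`, census chunk `rank2Rows61b`) whose named hypothesis `hlow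
: 2 ≤ rank_ℤ E(ℚ)` is DISCHARGED by a kernel certificate in the imported per-curve files, collected
as ONE list `kernelCertRowsE61`. Torsion class ℤ/8 (certificate
two_le_mordellWeilRank_of_kernelCertT8). Proved here, with no computation beyond list bookkeeping:
the list is a sublist of the census chunk (`decide`, kernel), hence of `rank2Table`; every listed
row has `2 ≤ rank_ℤ E(ℚ)` unconditionally (the per-curve `row` theorems); hence `L(E,1) = L′(E,1) =
0` EXACTLY for every listed curve given only the named literature fact `hGZK`
(Gross–Zagier–Kolyvagin), and `r_an(E) = rank_ℤ E(ℚ)` given `hGZK` and the remaining certificate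
fields `hup`, `hL2` as named hypotheses (`rank2_analyticRank_eq_rank_of_mem` with `hlow`
discharged). Rows of the same census range absent from the list are either indexed elsewhere or OUT
OF SCOPE of the kernel certificates (status per row in the cell's
`b2b-bsdr2-cert-1/kernel-certs/INDEX.tsv`); nothing is claimed for them here.

References: Cremona, *Algorithms for Modular Elliptic Curves* (1997), Table 1, §2.13, §3.5; Darmon,
*Rational Points on Modular Elliptic Curves* (2004), Thm. 3.22.
-/

-- single-conjunct summit: `Summit.BirchSwinnertonDyer.BirchSwinnertonDyer.…` repeats the name by design
set_option linter.dupNamespace false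

namespace Summit.BirchSwinnertonDyer.BirchSwinnertonDyer.Rank2Observatory

open WeierstrassCurve Literature Literature.NumberTheory.EllipticCurves

/-- The 1 kernel-certified rank-2 census rows of index E61 (census order; `rank2_table.tsv` sha256
`8b151c933b69ee8d…`). [cite: CremonaAlgorithms1997, Table 1] -/
def kernelCertRowsE61 : List Rank2Row := [
  ⟨"308490bx1", 1, 1, 1, -15141210, 22670813415, 308490, (2185, 3899, 1), (1093, 85643, 1)⟩]

/-- The index has `1` rows. [folklore] -/
theorem length_kernelCertRowsE61 : kernelCertRowsE61.length = 1 := by decide +kernel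

/-- The index is a sublist of census chunk `rank2Rows61b` (kernel `decide` on the derived
`DecidableEq Rank2Row`). [cite: CremonaAlgorithms1997, Table 1] -/
theorem kernelCertRowsE61_sublist : kernelCertRowsE61.Sublist rank2Rows61b := by
  decide +kernel

/-- Every row of the index is a row of the census table `rank2Table`.
[cite: CremonaAlgorithms1997, Table 1] -/
theorem mem_rank2Table_of_mem_kernelCertRowsE61 {r : Rank2Row} (hr : r ∈ kernelCertRowsE61) :
    r ∈ rank2Table :=
  mem_rank2Table_of_mem_decade rank2Decade6_mem_decades
    (mem_rank2Decade6_of_mem_chunk rank2Rows61b_mem_decade6 (kernelCertRowsE61_sublist.subset hr))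

/-- **Aggregated kernel rank certificate, index E61**: every listed row has `2 ≤ rank_ℤ E(ℚ)` —
with NO hypothesis (the per-curve `row` theorems, kernel-checked by `decide`).
[cite: CremonaAlgorithms1997, Table 1, §3.5] [cite: SilvermanAEC2009, Thm. VIII.6.7] -/
theorem two_le_mordellWeilRank_of_mem_kernelCertRowsE61 :
    ∀ r ∈ kernelCertRowsE61, 2 ≤ r.curve.mordellWeilRank := by
  simp only [kernelCertRowsE61, List.forall_mem_cons]
  exact ⟨
    KernelCertsE01.C308490bx1.row, by simp⟩

/-- **Exact vanishing `L(E,1) = L′(E,1) = 0` for every curve of index E61**, given ONLY the named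
literature fact `hGZK` (Gross–Zagier–Kolyvagin: `r_an ≤ 1 → rank = r_an`): the lower bound
`2 ≤ rank` is a kernel theorem.
[cite: Darmon2004, Thm. 3.22] [cite: CremonaAlgorithms1997, §2.13] -/
theorem lvalue_lderiv_eq_zero_of_mem_kernelCertRowsE61 {r : Rank2Row} (hr : r ∈ kernelCertRowsE61)
    (hGZK : rank_eq_analyticRank_of_analyticRank_le_one) :
    r.curve.entireLFunction 1 = 0 ∧ deriv r.curve.entireLFunction 1 = 0 :=
  ⟨rank2_lvalue_eq_zero_of_mem (mem_rank2Table_of_mem_kernelCertRowsE61 hr) hGZK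
      (two_le_mordellWeilRank_of_mem_kernelCertRowsE61 r hr),
    rank2_lderiv_eq_zero_of_mem (mem_rank2Table_of_mem_kernelCertRowsE61 hr) hGZK
      (two_le_mordellWeilRank_of_mem_kernelCertRowsE61 r hr)⟩

/-- **`r_an(E) = rank_ℤ E(ℚ)` for every curve of index E61** with the certificate field
`rank_lower` DISCHARGED: the remaining named hypotheses are `hGZK` (literature), `hup` (2-descent
upper bound) and `hL2` (`L″(E,1) ≠ 0`, certified interval).
[cite: CremonaAlgorithms1997, §2.13] [cite: Darmon2004, Thm. 3.22] -/
theorem analyticRank_eq_rank_of_mem_kernelCertRowsE61 {r : Rank2Row} (hr : r ∈ kernelCertRowsE61)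
    (hGZK : rank_eq_analyticRank_of_analyticRank_le_one) (hup : r.curve.mordellWeilRank ≤ 2)
    (hL2 : iteratedDeriv 2 r.curve.entireLFunction 1 ≠ 0) :
    r.curve.analyticRank = r.curve.mordellWeilRank ∧ r.curve.analyticRank = 2 :=
  ⟨rank2_analyticRank_eq_rank_of_mem (mem_rank2Table_of_mem_kernelCertRowsE61 hr) hGZK
      (two_le_mordellWeilRank_of_mem_kernelCertRowsE61 r hr) hup hL2,
    rank2_analyticRank_eq_two_of_mem (mem_rank2Table_of_mem_kernelCertRowsE61 hr) hGZK
      (two_le_mordellWeilRank_of_mem_kernelCertRowsE61 r hr) hup hL2⟩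

end Summit.BirchSwinnertonDyer.BirchSwinnertonDyer.Rank2Observatory
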